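import Summits.QuantumFields.BalabanUV.T4Continuum.Support.CovariantMeanBirthLedger

/-!
# `T4Continuum.CovariantMeanPropagation` (cell-tree module `Summits/QuantumFields/BalabanUV/T4Continuum/Support/CovariantMeanPropagation.lean`)
# — road P4 of the spine estimate NE1′, tangent-map formulation (v2): THE PROPAGATION NODE AT THE LEVEL OF FUNCTIONALS —
# the three analytic inputs of the road as HYPOTHESIS SHAPES on configurations → values (`StepLaws`: the DEPTH LAW `dl`,
# the insertion lemma's LOCALITY half `il_loc` «the one-step correction of a class member is a class member one level up»
# and its ANALYTIC half `il_an` «its class norm is ε times the parent's DEPTH VALUE», plus additivity of the correction),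
# and the WIRING THEOREM: the propagated functional `X (j+1) = X j + corr j (X j)` is, on the level-`j` regular
# configurations, bounded by the ledger `depthTotal C r y j` of `CovariantMeanBirthLedger` for the generation norms
# `y = ySeq C r ε y₀` (defined here by the ledger recursion), hence by `2C²·(r(1+η))^j·y₀`
# (cell `pub-balaban`, sub-cell `t4`, ROUND-2 prover seat #4 of BINDER-OWNERS row NE1′, unit `b2b-balaban-t4-ne1p-p4`,
# generation 3; companion of the HOME record `t4/b2b-balaban-t4-ne1p-p4/PROPAGATION-v2.md` §4.2–§4.4, §7.2 and of the skeleton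
# `t4/skeletons/NE1p-t4-ne1p-p4.md` v2.5 node P (leaves L8-IL = IL-an ∧ IL-loc, L8-DL, L8-REC); ADDITIVE — imports its sibling
# `Support.CovariantMeanBirthLedger` (p211942) only; nothing modified)

HONEST FRAMING.  Finite four-torus, rung (B)+1 only.  NOT infinite volume, NOT a mass gap, NOT the Clay problem, NOT summit
progress.  HONEST DEPENDENCY: continuum YM on T⁴ ⇐ BetaPertH ∧ nine spine estimates (0/9 proved); BetaPertH ⇐ (D1) ∧ (D4) ∧
CAP+tail; G-an2-4 gates asym, D1 and NE2/3/4.  This module is elementary (finite sums of functions, real arithmetic); the three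
laws are HYPOTHESIS SHAPES asserted of nothing — on the road `dl` is the lattice depth lemma (tree `CovariantMeanLatticeDisc` /
`CovariantMeanLatticeDepth`, for the class «covariant, exactly local, analytic on the birth space»), `il_loc` is the EXACT
localization of the one-step fluctuation correction into such class members (the road's OWN-OPEN half-lemma IL-loc, printed TYPE
only), `il_an` is the analytic half (road P3's quasi-positivity kernel adopted by name + the support description).  Every
declaration is [folklore] and sorry-free.  No object of T. Bałaban's is constructed.

CITATION HEADER (lean-in-tree rule).  No page of the series (CMP 1983–89) or of any other source is quoted or attributed here.
Objects re-used BY NAME: `CovariantMeanBirthLedger.depthTotal` / `depthTotal_le_geometric` (this seat, p211942).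
-/

noncomputable section

open Finset

namespace Summit.QuantumFields.BalabanUV.T4Continuum.CovariantMeanPropagation

open CovariantMeanBirthLedger (depthTotal depthTotal_zero depthTotal_le_geometric depthTotal_nonneg)

/-! ## §1 The generation norms defined by the ledger recursion -/

/-- The generation norms: `y 0 = y₀` (class norm of the birth functional) and `y (j+1) = ε·depthTotal C r y j` (each new
generation of corrections is `ε` times the total depth value of the previous level).  Defined by well-founded recursion.
[folklore] -/
def ySeq (C r ε y₀ : ℝ) : ℕ → ℝ
  | 0 => y₀
  | j + 1 => ε * (C * ∑ i : Fin (j + 1), r ^ (j - (i : ℕ)) * ySeq C r ε y₀ i)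
  decreasing_by exact i.isLt

/-- `ySeq … 0 = y₀`. [folklore] -/
@[simp] theorem ySeq_zero (C r ε y₀ : ℝ) : ySeq C r ε y₀ 0 = y₀ := by
  rw [ySeq]

/-- The defining recursion in ledger form: `ySeq (j+1) = ε·depthTotal C r ySeq j`. [folklore] -/
theorem ySeq_succ (C r ε y₀ : ℝ) (j : ℕ) :
    ySeq C r ε y₀ (j + 1) = ε * depthTotal C r (ySeq C r ε y₀) j := by
  rw [ySeq, depthTotal, ← Fin.sum_univ_eq_sum_range]

/-- The generation norms are non-negative for non-negative data. [folklore] -/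
theorem ySeq_nonneg {C r ε y₀ : ℝ} (hC : 0 ≤ C) (hr : 0 ≤ r) (hε : 0 ≤ ε) (hy₀ : 0 ≤ y₀) :
    ∀ i, 0 ≤ ySeq C r ε y₀ i := by
  intro i
  induction i using Nat.strong_induction_on with
  | _ i ih =>
    cases i with
    | zero => simpa using hy₀
    | succ j =>
      rw [ySeq_succ]
      refine mul_nonneg hε (mul_nonneg hC (sum_nonneg fun k hk => ?_))
      exact mul_nonneg (pow_nonneg hr _) (ih k (by simpa [Nat.lt_succ_iff] using mem_range_succ_iff.mp hk))

/-! ## §2 The three laws as hypothesis shapes, and the propagated functional -/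

section Laws

variable {Cfg F : Type*} [NormedAddCommGroup F]

/-- THE STEP LAWS (hypothesis shapes; asserted of nothing).  `D j` = the analyticity domain of level-`j` class members
(where their class norm is measured); `Reg j` = the level-`j` regular configurations near the attachment point (where the
loop's covector evaluates them); `Good j` = the level-`j` class (on the road: covariant, exactly `Y`-local, analytic on
`D j`; flat-vanishing is then a theorem); `corr j` = the one-step correction `Φ ↦ E_j[Φ ∣ ·] − Φ∘ι_j` (the step minus its
zeroth order, here with `ι` the identity on the common configuration space).  Laws: the class is an additive subgroup-like
family (`good_zero`, `good_add`), the correction is additive (`corr_add`), the DEPTH LAW `dl` (a level-`i` class member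
bounded by `N` on `D i` is bounded by `C·r^{j−i}·N` on `Reg j`), the LOCALITY half of the insertion lemma `il_loc` (the
correction of a level-`i` member at step `j ≥ i` is a level-`(j+1)` member) and its ANALYTIC half `il_an` (its class norm on
`D (j+1)` is at most `ε` times the parent's bound on `Reg j`). [folklore] -/
structure StepLaws (Cfg F : Type*) [NormedAddCommGroup F] where
  /-- analyticity domains, by level -/
  D : ℕ → Set Cfg
  /-- regular configurations near the attachment point, by level -/
  Reg : ℕ → Set Cfg
  /-- the class, by level -/
  Good : ℕ → (Cfg → F) → Prop
  /-- the one-step correction at step `j` -/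
  corr : ℕ → (Cfg → F) → (Cfg → F)
  /-- the depth constant -/
  C : ℝ
  /-- the depth rate per level -/
  r : ℝ
  /-- the relative size of a correction -/
  ε : ℝ
  good_zero : ∀ j, Good j 0
  good_add : ∀ j Φ Ψ, Good j Φ → Good j Ψ → Good j (Φ + Ψ)
  corr_add : ∀ j Φ Ψ, corr j (Φ + Ψ) = corr j Φ + corr j Ψ
  dl : ∀ i j (Φ : Cfg → F) (N : ℝ), i ≤ j → Good i Φ → (∀ V ∈ D i, ‖Φ V‖ ≤ N) → ∀ V ∈ Reg j, ‖Φ V‖ ≤ C * r ^ (j - i) * N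
  il_loc : ∀ i j (Φ : Cfg → F), i ≤ j → Good i Φ → Good (j + 1) (corr j Φ)
  il_an : ∀ i j (Φ : Cfg → F) (M : ℝ), i ≤ j → Good i Φ → (∀ W ∈ Reg j, ‖Φ W‖ ≤ M) →
    ∀ V ∈ D (j + 1), ‖corr j Φ V‖ ≤ ε * M

variable (L : StepLaws Cfg F)

/-- `corr j 0 = 0` (from additivity). [folklore] -/
theorem StepLaws.corr_zero (j : ℕ) : L.corr j 0 = 0 := by
  have h := L.corr_add j 0 0
  rw [add_zero] at h
  have : L.corr j 0 + L.corr j 0 = L.corr j 0 + 0 := by rw [add_zero]; exact h.symm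
  exact add_left_cancel this

/-- The correction of a finite sum is the sum of the corrections. [folklore] -/
theorem StepLaws.corr_sum (j : ℕ) {ι : Type*} (s : Finset ι) (P : ι → Cfg → F) :
    L.corr j (∑ i ∈ s, P i) = ∑ i ∈ s, L.corr j (P i) := by
  classical
  induction s using Finset.induction_on with
  | empty => simp [L.corr_zero]
  | insert a s ha ih => rw [sum_insert ha, sum_insert ha, L.corr_add, ih]

/-- A finite sum of level-`j` class members is a class member. [folklore] -/
theorem StepLaws.good_sum (j : ℕ) {ι : Type*} (s : Finset ι) (P : ι → Cfg → F) (h : ∀ i ∈ s, L.Good j (P i)) :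
    L.Good j (∑ i ∈ s, P i) := by
  classical
  induction s using Finset.induction_on with
  | empty => simpa using L.good_zero j
  | insert a s ha ih =>
      rw [sum_insert ha]
      exact L.good_add j _ _ (h a (mem_insert_self a s)) (ih fun i hi => h i (mem_insert_of_mem hi))

/-- THE PROPAGATED FUNCTIONAL: `X 0 = X₀`, `X (j+1) = X j + corr j (X j)` (the step at level `j` is «zeroth order + correction»).
[folklore] -/
def StepLaws.propagate (X₀ : Cfg → F) : ℕ → (Cfg → F)
  | 0 => X₀
  | j + 1 => StepLaws.propagate X₀ j + L.corr j (StepLaws.propagate X₀ j)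

/-- THE GENERATIONS: `P 0 = X₀` (birth), `P (j+1) = corr j (X j)` (the corrections born at step `j`). [folklore] -/
def StepLaws.piece (X₀ : Cfg → F) : ℕ → (Cfg → F)
  | 0 => X₀
  | j + 1 => L.corr j (L.propagate X₀ j)

/-- The propagated functional is the sum of its generations: `X j = Σ_{i≤j} P i`. [folklore] -/
theorem StepLaws.propagate_eq_sum (X₀ : Cfg → F) (j : ℕ) :
    L.propagate X₀ j = ∑ i ∈ range (j + 1), L.piece X₀ i := by
  induction j with
  | zero => simp [StepLaws.propagate, StepLaws.piece]
  | succ j ih =>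
      rw [sum_range_succ, ← ih]
      rfl

/-- Every generation is a class member of its own level (uses `il_loc` and additivity). [folklore] -/
theorem StepLaws.good_piece (X₀ : Cfg → F) (h₀ : L.Good 0 X₀) : ∀ i, L.Good i (L.piece X₀ i) := by
  intro i
  induction i using Nat.strong_induction_on with
  | _ i ih =>
    cases i with
    | zero => simpa [StepLaws.piece] using h₀
    | succ j =>
      show L.Good (j + 1) (L.corr j (L.propagate X₀ j))
      rw [L.propagate_eq_sum X₀ j, L.corr_sum]
      refine L.good_sum (j + 1) _ _ fun i hi => ?_
      have hij : i ≤ j := Nat.lt_succ_iff.mp (mem_range.mp hi)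
      exact L.il_loc i j _ hij (ih i (Nat.lt_succ_of_le hij))

/-- THE GENERATION BOUNDS: the generation born at step `j` has class norm `≤ ySeq C r ε y₀ (j+1)` on `D (j+1)` — by `il_an` applied
to each parent generation with the parent's depth value from `dl`. [folklore] -/
theorem StepLaws.piece_bound (X₀ : Cfg → F) {y₀ : ℝ} (h₀ : L.Good 0 X₀) (hX₀ : ∀ V ∈ L.D 0, ‖X₀ V‖ ≤ y₀) :
    ∀ i, ∀ V ∈ L.D i, ‖L.piece X₀ i V‖ ≤ ySeq L.C L.r L.ε y₀ i := by
  intro i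
  induction i using Nat.strong_induction_on with
  | _ i ih =>
    cases i with
    | zero => simpa [StepLaws.piece] using hX₀
    | succ j =>
      intro V hV
      show ‖L.corr j (L.propagate X₀ j) V‖ ≤ ySeq L.C L.r L.ε y₀ (j + 1)
      rw [L.propagate_eq_sum X₀ j, L.corr_sum, Finset.sum_apply, ySeq_succ, depthTotal, mul_sum, mul_sum]
      refine (norm_sum_le _ _).trans (sum_le_sum fun i hi => ?_)
      have hij : i ≤ j := Nat.lt_succ_iff.mp (mem_range.mp hi)
      -- depth value of the parent generation `i` at level `j`, from `dl` and the induction hypothesis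
      have hdepth : ∀ W ∈ L.Reg j, ‖L.piece X₀ i W‖ ≤ L.C * L.r ^ (j - i) * ySeq L.C L.r L.ε y₀ i :=
        L.dl i j _ _ hij (L.good_piece X₀ h₀ i) (ih i (Nat.lt_succ_of_le hij))
      have h := L.il_an i j _ _ hij (L.good_piece X₀ h₀ i) hdepth V hV
      calc ‖L.corr j (L.piece X₀ i) V‖ ≤ L.ε * (L.C * L.r ^ (j - i) * ySeq L.C L.r L.ε y₀ i) := h
        _ = L.ε * (L.C * (L.r ^ (j - i) * ySeq L.C L.r L.ε y₀ i)) := by ring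

/-- **THE WIRING THEOREM (depth value of the propagated functional).**  Under the step laws, a level-`0` class member `X₀`
with class norm `≤ y₀` propagates to `X j` with `‖X j V‖ ≤ depthTotal C r (ySeq C r ε y₀) j` at every level-`j` regular
configuration `V`. [folklore] -/
theorem StepLaws.norm_propagate_le_depthTotal (X₀ : Cfg → F) {y₀ : ℝ} (h₀ : L.Good 0 X₀)
    (hX₀ : ∀ V ∈ L.D 0, ‖X₀ V‖ ≤ y₀) (j : ℕ) :
    ∀ V ∈ L.Reg j, ‖L.propagate X₀ j V‖ ≤ depthTotal L.C L.r (ySeq L.C L.r L.ε y₀) j := by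
  intro V hV
  rw [L.propagate_eq_sum X₀ j, Finset.sum_apply, depthTotal, mul_sum]
  refine (norm_sum_le _ _).trans (sum_le_sum fun i hi => ?_)
  have hij : i ≤ j := Nat.lt_succ_iff.mp (mem_range.mp hi)
  have h := L.dl i j _ _ hij (L.good_piece X₀ h₀ i) (L.piece_bound X₀ h₀ hX₀ i) V hV
  calc ‖L.piece X₀ i V‖ ≤ L.C * L.r ^ (j - i) * ySeq L.C L.r L.ε y₀ i := h
    _ = L.C * (L.r ^ (j - i) * ySeq L.C L.r L.ε y₀ i) := by ring

/-- **THE WIRING THEOREM (geometric decay).**  With `C ≥ 1`, `r > 0`, `η > 0`, `0 ≤ ε ≤ rη/(2C)` and `y₀ ≥ 0`: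
`‖X j V‖ ≤ 2C·(r(1+η))^j·(C·y₀)` at every level-`j` regular configuration — the first-order member of the road decays per level
at the rate `r(1+η)` with the constant paid once (`CovariantMeanBirthLedger.depthTotal_le_geometric` ∘
`CovariantMeanRecursion.le_geometric_of_recursion`). [folklore] -/
theorem StepLaws.norm_propagate_le_geometric (X₀ : Cfg → F) {y₀ η : ℝ} (h₀ : L.Good 0 X₀)
    (hX₀ : ∀ V ∈ L.D 0, ‖X₀ V‖ ≤ y₀) (hy₀ : 0 ≤ y₀) (hC : 1 ≤ L.C) (hr : 0 < L.r) (hη : 0 < η) (hε0 : 0 ≤ L.ε)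
    (hε : L.ε ≤ L.r * η / (2 * L.C)) (j : ℕ) :
    ∀ V ∈ L.Reg j, ‖L.propagate X₀ j V‖ ≤ 2 * L.C * (L.r * (1 + η)) ^ j * (L.C * y₀) := by
  intro V hV
  have h1 := L.norm_propagate_le_depthTotal X₀ h₀ hX₀ j V hV
  have hy := ySeq_nonneg (zero_le_one.trans hC) hr.le hε0 hy₀ (C := L.C) (r := L.r) (ε := L.ε)
  have h2 := depthTotal_le_geometric hC hr hη hε0 hε hy (fun i => (ySeq_succ L.C L.r L.ε y₀ i).le) j
  rw [ySeq_zero] at h2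
  exact h1.trans h2

/-- … and the class norm of the generation born at step `j` is `≤ ε·2C²·(r(1+η))^j·y₀`. [folklore] -/
theorem StepLaws.norm_piece_le_geometric (X₀ : Cfg → F) {y₀ η : ℝ} (h₀ : L.Good 0 X₀)
    (hX₀ : ∀ V ∈ L.D 0, ‖X₀ V‖ ≤ y₀) (hy₀ : 0 ≤ y₀) (hC : 1 ≤ L.C) (hr : 0 < L.r) (hη : 0 < η) (hε0 : 0 ≤ L.ε)
    (hε : L.ε ≤ L.r * η / (2 * L.C)) (j : ℕ) :
    ∀ V ∈ L.D (j + 1), ‖L.piece X₀ (j + 1) V‖ ≤ L.ε * (2 * L.C * (L.r * (1 + η)) ^ j * (L.C * y₀)) := by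
  intro V hV
  have h1 := L.piece_bound X₀ h₀ hX₀ (j + 1) V hV
  have hy := ySeq_nonneg (zero_le_one.trans hC) hr.le hε0 hy₀ (C := L.C) (r := L.r) (ε := L.ε)
  have h2 := depthTotal_le_geometric hC hr hη hε0 hε hy (fun i => (ySeq_succ L.C L.r L.ε y₀ i).le) j
  rw [ySeq_zero] at h2
  rw [ySeq_succ] at h1
  exact h1.trans (mul_le_mul_of_nonneg_left h2 hε0)

end Laws

/-! ## §3 Non-vacuity: the laws are consistent (the zero correction) -/

section Witness

variable {Cfg F : Type*} [NormedAddCommGroup F]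

/-- THE ZERO-CORRECTION INSTANCE: one domain for all levels, every functional in the class, zero correction, `C = 1`,
`r = 1`, `ε = 0` — all laws hold; so the structure `StepLaws` is inhabited over any configuration space. [folklore] -/
def StepLaws.zeroCorr (S : Set Cfg) : StepLaws Cfg F where
  D := fun _ => S
  Reg := fun _ => S
  Good := fun _ _ => True
  corr := fun _ _ => 0
  C := 1
  r := 1
  ε := 0
  good_zero := fun _ => True.intro
  good_add := fun _ _ _ _ _ => True.intro
  corr_add := fun _ _ _ => by simp
  dl := fun i j Φ N _ _ hN V hV => by simpa using hN V hV
  il_loc := fun _ _ _ _ _ => True.intro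
  il_an := fun i j Φ M _ _ _ V _ => by simp

/-- In the zero-correction instance the propagated functional is constant: `X j = X₀`. [folklore] -/
theorem StepLaws.propagate_zeroCorr (S : Set Cfg) (X₀ : Cfg → F) (j : ℕ) :
    (StepLaws.zeroCorr (F := F) S).propagate X₀ j = X₀ := by
  induction j with
  | zero => rfl
  | succ j ih =>
      show (StepLaws.zeroCorr (F := F) S).propagate X₀ j + 0 = X₀
      rw [add_zero, ih]

end Witness

end Summit.QuantumFields.BalabanUV.T4Continuum.CovariantMeanPropagation

end
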